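import Summits.Ventures.CertifiedArithmetic.LowPrec.OptTreeChain2

/-!
# Opt / CM-T — Theorem T3(a), chain 3 (binade climbing), for EVERY tree shape: `(3+2λ)/(515+2λ)`

HONEST FRAMING: certified error envelopes and provably optimal rounding/accumulation schemes for
low-precision formats under stated cost models; every table by two implementations; no hardware or
vendor claims.

Setting as in `OptTreeChain.lean` / `OptTreeChain2.lean` (OPTIMA.md §T, Theorem T3; E2M1 × E2M1
products summed by a fixed binary tree in bfloat16, round to nearest even). CHAIN 3 of T3(a): at a node
`v` BOTH of whose children have `≥ 3` leaves, one child computes `(36 + 36) + 9/4 = 74¼ ↦ 74` (a midpoint,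
even neighbour kept, loss `¼`), the other computes `(36 + 18) + ½ = 54½` exactly, and `v` computes
`74 + 54½ = 128½ ↦ 128` (loss `½`): the partial sum has CLIMBED into the binade `[128, 256)` where the
spacing is `1`, so every higher node on the path can absorb a further `½` from its sibling subtree
(`fl(128 + ½) = 128`, loss `½` each). With `λ` the largest depth of such a node `v` this gives `ŝ = 128`,
`s = Σ|tᵢ| = (515 + 2λ)/4`, i.e. `|ŝ - s| / Σ|tᵢ| = (3+2λ)/(515+2λ)` — the chain-3 part of the three-chain
lower bound `W(shape) ≥ LB3(shape) = max((h-1)/(287+h), κ/(256+κ), (3+2λ)/(515+2λ))` of OPTIMA.md T3(a).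
Chains 1 and 2 are `t3_chain1_ratio` and `t3_chain2_ratio`; with this file ALL THREE CHAINS, i.e. the
lower bound `LB3` itself, are kernel-checked for every tree shape (the upper bounds / exactness of `LB3`
for `n ≤ 12` and the optimality of recursive halving for `n ≤ 48` remain certificate C12).

Encoding: `mu t = λ + 1` when `t` has a node both of whose children have `≥ 3` leaves, and `mu t = 0`
otherwise (a priority-ordered recursion); in terms of `μ = mu t ≥ 1` the identity reads
`s = Σ|tᵢ| = 128 + ¼ + μ/2` and `|ŝ - s| / Σ|tᵢ| = (1+2μ)/(513+2μ) = (3+2λ)/(515+2λ)`.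

* `mu`, `partA`, `partB`, `chain3`: the invariant and the witness relabelling (`spike_zero_chain3`: same shape);
* `partA_spec` (`74¼ ↦ 74`), `partB_spec` (`54½` exact), `chain3_spec` (`ŝ = 128`, `s = Σ|tᵢ| = 128¼ + μ/2`);
* `t3_chain3_ratio`: the packaged lower-bound witness with all leaves in the product alphabet `piE2M1`.
-/

namespace Summit.Ventures.CertifiedArithmetic.LowPrec.Opt

open Literature.ComputerArithmetic.JeannerodRump2018 (SumTree)
open Literature.ComputerArithmetic.FloatingPoint (Format)
open Literature.ComputerArithmetic.FloatingPoint.MiniFloat (flα absLeafSum treeHeight piE2M1)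

/-- `mu t = 1 + (largest depth of a node both of whose children have ≥ 3 leaves)`, `0` if there is no
such node (priority-ordered recursion). [new] -/
def mu : SumTree → ℕ
  | .leaf _ => 0
  | .node l r =>
      if mu l ≠ 0 ∧ mu r ≤ mu l then mu l + 1
      else if mu r ≠ 0 then mu r + 1
      else if 3 ≤ numLeaves l ∧ 3 ≤ numLeaves r then 1 else 0

/-- Child `A` of the climbing node: `(36 + 36) + 9/4` (on a tree with ≥ 3 leaves). [new] -/
def partA : SumTree → SumTree
  | .leaf _ => .leaf 0
  | .node a b => if 2 ≤ numLeaves a then .node (spike2 36 36 a) (spike (9 / 4) b)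
                 else .node (spike (9 / 4) a) (spike2 36 36 b)

/-- Child `B` of the climbing node: `(36 + 18) + ½` (on a tree with ≥ 3 leaves). [new] -/
def partB : SumTree → SumTree
  | .leaf _ => .leaf 0
  | .node a b => if 2 ≤ numLeaves a then .node (spike2 36 18 a) (spike (1 / 2) b)
                 else .node (spike (1 / 2) a) (spike2 36 18 b)

/-- The chain-3 witness relabelling of `t`: descend towards a deepest node both of whose children have
`≥ 3` leaves, relabel its children by `partA` / `partB`, and let the sibling subtree of every higher path
node carry one `½`. [new] -/
def chain3 : SumTree → SumTree
  | .leaf _ => .leaf 0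
  | .node l r =>
      if mu l ≠ 0 ∧ mu r ≤ mu l then .node (chain3 l) (spike (1 / 2) r)
      else if mu r ≠ 0 then .node (spike (1 / 2) l) (chain3 r)
      else .node (partA l) (partB r)

/-! ### bfloat16 facts (executable model, kernel-checked) -/

/-- `fl(18) = 18`. [folklore] -/
theorem flBF_18 : flα Format.BFloat16 18 = 18 := by decide +kernel
/-- `fl(½) = ½`. [folklore] -/
theorem flBF_half : flα Format.BFloat16 (1 / 2) = 1 / 2 := by decide +kernel
/-- `fl(9/4) = 9/4`. [folklore] -/
theorem flBF_9q : flα Format.BFloat16 (9 / 4) = 9 / 4 := by decide +kernel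
/-- `36 + 36 = 72` is exact. [folklore] -/
theorem flBF_36_36 : flα Format.BFloat16 (36 + 36) = 72 := by decide +kernel
/-- `36 + 18 = 54` is exact. [folklore] -/
theorem flBF_36_18 : flα Format.BFloat16 (36 + 18) = 54 := by decide +kernel
/-- THE FIRST TIE: `72 + 9/4 = 74¼ ↦ 74` (midpoint of `74` and `74.5`; even kept). [folklore] -/
theorem flBF_72_9q : flα Format.BFloat16 (72 + 9 / 4) = 74 := by decide +kernel
/-- Mirrored: `9/4 + 72 ↦ 74`. [folklore] -/
theorem flBF_9q_72 : flα Format.BFloat16 (9 / 4 + 72) = 74 := by decide +kernel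
/-- `54 + ½ = 54½` is exact (spacing `¼` on `[32, 64)`). [folklore] -/
theorem flBF_54_half : flα Format.BFloat16 (54 + 1 / 2) = 109 / 2 := by decide +kernel
/-- Mirrored: `½ + 54 = 54½`. [folklore] -/
theorem flBF_half_54 : flα Format.BFloat16 (1 / 2 + 54) = 109 / 2 := by decide +kernel
/-- THE CLIMB: `74 + 54½ = 128½ ↦ 128` (spacing `1` on `[128, 256)`; midpoint, even kept). [folklore] -/
theorem flBF_74_109h : flα Format.BFloat16 (74 + 109 / 2) = 128 := by decide +kernel
/-- THE PATH TIE: `fl(128 + ½) = 128`. [folklore] -/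
theorem flBF_128_half : flα Format.BFloat16 (128 + 1 / 2) = 128 := by decide +kernel
/-- Mirrored: `fl(½ + 128) = 128`. [folklore] -/
theorem flBF_half_128 : flα Format.BFloat16 (1 / 2 + 128) = 128 := by decide +kernel

/-! ### The two children of the climbing node -/

/-- `partA`: shape, leaves, `ŝ = 74`, `s = Σ|tᵢ| = 74¼`. [new] -/
theorem partA_spec (t : SumTree) (h3 : 3 ≤ numLeaves t) :
    spike 0 (partA t) = spike 0 t ∧ (∀ x ∈ SumTree.leaves (partA t), x = 36 ∨ x = 9 / 4 ∨ x = 0) ∧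
    SumTree.eval (flα Format.BFloat16) (partA t) = 74 ∧ SumTree.exact (partA t) = 74 + 1 / 4 ∧
    absLeafSum (partA t) = 74 + 1 / 4 := by
  obtain ⟨a, b, rfl⟩ := exists_node_of_two_le t (by omega)
  have h3' : 3 ≤ numLeaves a + numLeaves b := h3
  have ha1 := numLeaves_pos a
  have hb1 := numLeaves_pos b
  simp only [partA]
  split_ifs with c
  · obtain ⟨a1, a2, rfl⟩ := exists_node_of_two_le a c
    refine ⟨?_, ?_, ?_, ?_, ?_⟩
    · simp only [spike, spike2, spike_zero_spike]
    · intro x hx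
      simp only [spike2, SumTree.leaves, List.mem_append] at hx
      rcases hx with (hx | hx) | hx
      · rcases leaves_spike 36 a1 x hx with h | h
        · exact Or.inl h
        · exact Or.inr (Or.inr h)
      · rcases leaves_spike 36 a2 x hx with h | h
        · exact Or.inl h
        · exact Or.inr (Or.inr h)
      · rcases leaves_spike (9 / 4) b x hx with h | h
        · exact Or.inr (Or.inl h)
        · exact Or.inr (Or.inr h)
    · simp only [SumTree.eval, eval_spike2 36 36 flBF_36 flBF_36, eval_spike (9 / 4) flBF_9q b, flBF_36_36, flBF_72_9q]
    · simp only [SumTree.exact, exact_spike2, exact_spike]; norm_num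
    · simp only [absLeafSum, absLeafSum_spike2, absLeafSum_spike]; norm_num
  · obtain ⟨b1, b2, rfl⟩ := exists_node_of_two_le b (by omega)
    refine ⟨?_, ?_, ?_, ?_, ?_⟩
    · simp only [spike, spike2, spike_zero_spike]
    · intro x hx
      simp only [spike2, SumTree.leaves, List.mem_append] at hx
      rcases hx with hx | (hx | hx)
      · rcases leaves_spike (9 / 4) a x hx with h | h
        · exact Or.inr (Or.inl h)
        · exact Or.inr (Or.inr h)
      · rcases leaves_spike 36 b1 x hx with h | h
        · exact Or.inl h
        · exact Or.inr (Or.inr h)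
      · rcases leaves_spike 36 b2 x hx with h | h
        · exact Or.inl h
        · exact Or.inr (Or.inr h)
    · simp only [SumTree.eval, eval_spike2 36 36 flBF_36 flBF_36, eval_spike (9 / 4) flBF_9q a, flBF_36_36, flBF_9q_72]
    · simp only [SumTree.exact, exact_spike2, exact_spike]; norm_num
    · simp only [absLeafSum, absLeafSum_spike2, absLeafSum_spike]; norm_num

/-- `partB`: shape, leaves, `ŝ = s = Σ|tᵢ| = 54½`. [new] -/
theorem partB_spec (t : SumTree) (h3 : 3 ≤ numLeaves t) :
    spike 0 (partB t) = spike 0 t ∧ (∀ x ∈ SumTree.leaves (partB t), x = 36 ∨ x = 18 ∨ x = 1 / 2 ∨ x = 0) ∧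
    SumTree.eval (flα Format.BFloat16) (partB t) = 109 / 2 ∧ SumTree.exact (partB t) = 109 / 2 ∧
    absLeafSum (partB t) = 109 / 2 := by
  obtain ⟨a, b, rfl⟩ := exists_node_of_two_le t (by omega)
  have h3' : 3 ≤ numLeaves a + numLeaves b := h3
  have ha1 := numLeaves_pos a
  have hb1 := numLeaves_pos b
  simp only [partB]
  split_ifs with c
  · obtain ⟨a1, a2, rfl⟩ := exists_node_of_two_le a c
    refine ⟨?_, ?_, ?_, ?_, ?_⟩
    · simp only [spike, spike2, spike_zero_spike]
    · intro x hx
      simp only [spike2, SumTree.leaves, List.mem_append] at hx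
      rcases hx with (hx | hx) | hx
      · rcases leaves_spike 36 a1 x hx with h | h
        · exact Or.inl h
        · exact Or.inr (Or.inr (Or.inr h))
      · rcases leaves_spike 18 a2 x hx with h | h
        · exact Or.inr (Or.inl h)
        · exact Or.inr (Or.inr (Or.inr h))
      · rcases leaves_spike (1 / 2) b x hx with h | h
        · exact Or.inr (Or.inr (Or.inl h))
        · exact Or.inr (Or.inr (Or.inr h))
    · simp only [SumTree.eval, eval_spike2 36 18 flBF_36 flBF_18, eval_spike (1 / 2) flBF_half b, flBF_36_18, flBF_54_half]
    · simp only [SumTree.exact, exact_spike2, exact_spike]; norm_num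
    · simp only [absLeafSum, absLeafSum_spike2, absLeafSum_spike]; norm_num
  · obtain ⟨b1, b2, rfl⟩ := exists_node_of_two_le b (by omega)
    refine ⟨?_, ?_, ?_, ?_, ?_⟩
    · simp only [spike, spike2, spike_zero_spike]
    · intro x hx
      simp only [spike2, SumTree.leaves, List.mem_append] at hx
      rcases hx with hx | (hx | hx)
      · rcases leaves_spike (1 / 2) a x hx with h | h
        · exact Or.inr (Or.inr (Or.inl h))
        · exact Or.inr (Or.inr (Or.inr h))
      · rcases leaves_spike 36 b1 x hx with h | h
        · exact Or.inl h
        · exact Or.inr (Or.inr (Or.inr h))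
      · rcases leaves_spike 18 b2 x hx with h | h
        · exact Or.inr (Or.inl h)
        · exact Or.inr (Or.inr (Or.inr h))
    · simp only [SumTree.eval, eval_spike2 36 18 flBF_36 flBF_18, eval_spike (1 / 2) flBF_half a, flBF_36_18, flBF_half_54]
    · simp only [SumTree.exact, exact_spike2, exact_spike]; norm_num
    · simp only [absLeafSum, absLeafSum_spike2, absLeafSum_spike]; norm_num

/-! ### The chain-3 witness -/

/-- The defining equation of `mu` at a node. [new] -/
theorem mu_node (l r : SumTree) : mu (.node l r) =
    (if mu l ≠ 0 ∧ mu r ≤ mu l then mu l + 1 else if mu r ≠ 0 then mu r + 1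
      else if 3 ≤ numLeaves l ∧ 3 ≤ numLeaves r then 1 else 0) := by
  rw [mu]

/-- If `mu t ≠ 0` and neither child has a climbing node then both children have `≥ 3` leaves. [new] -/
theorem three_le_of_mu (l r : SumTree) (h : mu (.node l r) ≠ 0) (c1 : ¬(mu l ≠ 0 ∧ mu r ≤ mu l))
    (c2 : ¬(mu r ≠ 0)) : 3 ≤ numLeaves l ∧ 3 ≤ numLeaves r := by
  rw [mu_node, if_neg c1, if_neg c2] at h
  by_contra hc
  rw [if_neg hc] at h
  exact h rfl

/-- THE INDUCTION: for a tree with a climbing node (`mu t ≠ 0`) the witness has the shape of `t`, leaves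
in `{36, 18, 9/4, ½, 0}`, evaluates to `128`, and has exact sum = leaf mass `128¼ + μ/2`. [new] -/
theorem chain3_spec : ∀ t, mu t ≠ 0 →
    spike 0 (chain3 t) = spike 0 t ∧
    (∀ x ∈ SumTree.leaves (chain3 t), x = 36 ∨ x = 18 ∨ x = 9 / 4 ∨ x = 1 / 2 ∨ x = 0) ∧
    SumTree.eval (flα Format.BFloat16) (chain3 t) = 128 ∧
    SumTree.exact (chain3 t) = 128 + 1 / 4 + (mu t : ℚ) / 2 ∧
    absLeafSum (chain3 t) = 128 + 1 / 4 + (mu t : ℚ) / 2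
  | .leaf _, h => by simp [mu] at h
  | .node l r, h => by
      unfold chain3
      split_ifs with c1 c2
      · -- descend left: `fl(128 + ½) = 128`
        have hk : mu (.node l r) = mu l + 1 := by rw [mu_node, if_pos c1]
        obtain ⟨hs, hl, he, hx, ha⟩ := chain3_spec l c1.1
        refine ⟨?_, ?_, ?_, ?_, ?_⟩
        · simp only [spike, hs, spike_zero_spike]
        · intro x hx'
          simp only [SumTree.leaves, List.mem_append] at hx'
          rcases hx' with hx' | hx'
          · exact hl x hx'
          · rcases leaves_spike (1 / 2) r x hx' with h' | h'
            · exact Or.inr (Or.inr (Or.inr (Or.inl h')))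
            · exact Or.inr (Or.inr (Or.inr (Or.inr h')))
        · simp only [SumTree.eval, he, eval_spike (1 / 2) flBF_half r, flBF_128_half]
        · simp only [SumTree.exact, hx, exact_spike, hk]; push_cast; ring
        · simp only [absLeafSum, ha, absLeafSum_spike, hk]; push_cast
          rw [abs_of_pos (by norm_num : (0 : ℚ) < 1 / 2)]; ring
      · -- descend right
        have hk : mu (.node l r) = mu r + 1 := by rw [mu_node, if_neg c1, if_pos c2]
        obtain ⟨hs, hl, he, hx, ha⟩ := chain3_spec r c2
        refine ⟨?_, ?_, ?_, ?_, ?_⟩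
        · simp only [spike, hs, spike_zero_spike]
        · intro x hx'
          simp only [SumTree.leaves, List.mem_append] at hx'
          rcases hx' with hx' | hx'
          · rcases leaves_spike (1 / 2) l x hx' with h' | h'
            · exact Or.inr (Or.inr (Or.inr (Or.inl h')))
            · exact Or.inr (Or.inr (Or.inr (Or.inr h')))
          · exact hl x hx'
        · simp only [SumTree.eval, he, eval_spike (1 / 2) flBF_half l, flBF_half_128]
        · simp only [SumTree.exact, hx, exact_spike, hk]; push_cast; ring
        · simp only [absLeafSum, ha, absLeafSum_spike, hk]; push_cast
          rw [abs_of_pos (by norm_num : (0 : ℚ) < 1 / 2)]; ring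
      · -- the climbing node itself: `74 + 54½ = 128½ ↦ 128`
        have hk : mu (.node l r) = 1 := by
          have h33 := three_le_of_mu l r h c1 c2
          rw [mu_node, if_neg c1, if_neg c2, if_pos h33]
        obtain ⟨h3l, h3r⟩ := three_le_of_mu l r h c1 c2
        obtain ⟨as, al, ae, ax, aa⟩ := partA_spec l h3l
        obtain ⟨bs, bl, be, bx, ba⟩ := partB_spec r h3r
        refine ⟨?_, ?_, ?_, ?_, ?_⟩
        · simp only [spike, as, bs]
        · intro x hx'
          simp only [SumTree.leaves, List.mem_append] at hx'
          rcases hx' with hx' | hx'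
          · rcases al x hx' with h' | h' | h'
            · exact Or.inl h'
            · exact Or.inr (Or.inr (Or.inl h'))
            · exact Or.inr (Or.inr (Or.inr (Or.inr h')))
          · rcases bl x hx' with h' | h' | h' | h'
            · exact Or.inl h'
            · exact Or.inr (Or.inl h')
            · exact Or.inr (Or.inr (Or.inr (Or.inl h')))
            · exact Or.inr (Or.inr (Or.inr (Or.inr h')))
        · simp only [SumTree.eval, ae, be, flBF_74_109h]
        · rw [hk]; simp only [SumTree.exact, ax, bx]; norm_num
        · rw [hk]; simp only [absLeafSum, aa, ba]; norm_num

/-- Every leaf of the witness is an `E2M1 × E2M1` product (`36 = 6·6`, `18 = 6·3`, `9/4 = 1½·1½`,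
`½ = 1·½`, `0`). [new] -/
theorem chain3_leaves_mem (t : SumTree) (h : mu t ≠ 0) : ∀ x ∈ SumTree.leaves (chain3 t), x ∈ piE2M1 := by
  intro x hx
  rcases (chain3_spec t h).2.1 x hx with rfl | rfl | rfl | rfl | rfl <;> norm_num [piE2M1]

/-- OPTIMA.md Theorem T3(a), chain 3 (binade climbing), ALL shapes: every reduction tree `t` having a node
both of whose children have `≥ 3` leaves admits a relabelling of the same shape by `E2M1 × E2M1` products
whose bfloat16 (RNE) evaluation has relative error EXACTLY `(1+2μ)/(513+2μ) = (3+2λ)/(515+2λ)`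
(`μ = mu t = λ + 1`, `λ` the largest depth of such a node); hence `W(shape) ≥ (3+2λ)/(515+2λ)`. [new] -/
theorem t3_chain3_ratio (t : SumTree) (h : mu t ≠ 0) :
    spike 0 (chain3 t) = spike 0 t ∧ (∀ x ∈ SumTree.leaves (chain3 t), x ∈ piE2M1) ∧
    |SumTree.eval (flα Format.BFloat16) (chain3 t) - SumTree.exact (chain3 t)| / absLeafSum (chain3 t)
      = (1 + 2 * (mu t : ℚ)) / (513 + 2 * (mu t : ℚ)) := by
  obtain ⟨hs, _, he, hx, ha⟩ := chain3_spec t h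
  refine ⟨hs, chain3_leaves_mem t h, ?_⟩
  have h0 : (0 : ℚ) ≤ mu t := by exact_mod_cast Nat.zero_le _
  rw [he, hx, ha, show (128 : ℚ) - (128 + 1 / 4 + (mu t : ℚ) / 2) = -(1 / 4 + (mu t : ℚ) / 2) by ring,
    abs_neg, abs_of_nonneg (by linarith)]
  have hne : (128 : ℚ) + 1 / 4 + (mu t : ℚ) / 2 ≠ 0 := ne_of_gt (by linarith)
  have hne' : (513 : ℚ) + 2 * (mu t : ℚ) ≠ 0 := ne_of_gt (by linarith)
  rw [div_eq_div_iff hne hne']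
  ring

/-- Instance (sanity, kernel-checked): the recursive-halving shape on `48 = 24 + 24` leaves has
`μ = 4` (`λ = 3`: the `(3,3)` nodes sit at depth `3`), so `W ≥ 9/521` — its certified exact value (C12,
`n = 41..48`), where chains 1 and 2 only give `5/293` and `1/65`. Here checked on the smaller `(6,6)`
shape on twelve leaves: `μ = 2` (`λ = 1`), ratio `5/517`. [new] -/
example : mu (.node (.node (.node (.node (.leaf 0) (.leaf 0)) (.leaf 0)) (.node (.node (.leaf 0) (.leaf 0)) (.leaf 0)))
    (.node (.node (.node (.leaf 0) (.leaf 0)) (.leaf 0)) (.node (.node (.leaf 0) (.leaf 0)) (.leaf 0)))) = 2 := by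
  decide

end Summit.Ventures.CertifiedArithmetic.LowPrec.Opt
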